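import Summits.QuantumFields.YangMills.Theorems.LuscherReductionTwistedTraceScalingBaseWindow
import HarnessLib

/-!
# The uniform femto trace law `UTL` (⇒ S-TOWER of line «twolattice», crux `TwistedTraceScaling`, stmt-QuantumFields-20203) REDUCED to
# three `L`-UNIFORM level statements `U-UPPER ∧ U-LOWER ∧ U-TAIL` — the composition, kernel-checked (no sorry, no definitions)

Route `LuscherReduction` (owner ym-beyond-p1), child crux `TwistedTraceScaling` (stmt-QuantumFields-20203), registered birth line
«twolattice» (`pub/ym-beyond/p1-g20-files/Lines-twolattice.lean`, sha16 a5c3dbcbf75f28d1), load-bearing stub S-TOWER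
`Stmt.stub_twoLatticeUniversality`.  The companion file `…TwistedTraceScalingTowerOfUniform.lean` shows S-TOWER ⇐ `UTL` (and
`TOWER ∧ BASE ⇒ UTL`), where

  `UTL := ∀ s > 0, ∀ ε > 0, ∃ L0, ∃ lam0 > 0, ∀ lam ∈ (0, lam0], ∀ L ≥ L0, ∀ β ∈ W(lam, L), |traceRatio L β (femtoSteps s β L) − hTraceRatio s| ≤ ε`

is the femto trace law with an `L`-UNIFORM threshold.  This file is the `L`-uniform twin of `Base.fixedLatticeTraceLaw_of_coarse`
(ym-luscher-20007-p1 g5, S-BASE ⇐ COARSE-UPPER/LOWER/TAIL(L₁) at ONE lattice size): with `λ_k = levelValue su2Rep L β k`,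
`u = Λ(β,L)/L`, `Δ_k = levelGap k`, and «deep» meaning `0 < lam ≤ lam0 ∧ L ≥ L0 ∧ InFemtoWindow lam β L` with `L0` NOT depending on `lam`,

* `U-UPPER`: for every `k` and `d < Δ_k`, deep: `λ_k ≤ e^{−d·u} λ_0` (no intruders below the `k`-th shell, uniformly in `L`);
* `U-LOWER`: for every `k` and `ε > 0`, deep: `e^{−(Δ_k+ε)·u} λ_0 ≤ λ_k` (trial states, uniformly in `L`);
* `U-TAIL`: for every `s > 0`, `ε > 0` there is `K`, deep, for every `T` with `s ≤ 2T·u`: `Σ_k (λ_{k+K}/λ_0)^T ≤ ε` (uniform tail).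

THEOREM `Tower.uniformTraceLaw_of_ucoarse : U-UPPER → U-LOWER → U-TAIL → UTL` (§3), through the uniform termwise / moment / ratio
limits of §2 (`uterm_close`, `umoment_close`, `ulevelRatio_close`); thresholds are pairs `(L0, lam0)` combined by `max`/`min` (finitely
many levels below the tail cut: `Σ L0_k` and `1/(Σ lam0_k⁻¹ + 1)`), the femto unit is small uniformly (`u ≤ 2·lam`, tree
`Base.unit_le_of_window`), LEVEL = TRACE currency on every lattice is the closed child `TraceFormula` (tree `Base.traceRatio_eq_levelRatio`),
`LevelGapSummable` = `LGS.levelGapSummable_all`.  At fixed `L` the three hypotheses are COARSE-UPPER/LOWER/TAIL(L); the fixed-`k`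
two-sided femto level law with `lam`-dependent `L0` is the tree's OPEN leaf `FemtoLevelsOfRecord` (node N34) — `U-UPPER ∧ U-LOWER` is that
law with slack `d < Δ_k` / `Δ_k + ε` and a `lam`-UNIFORM `L0`, i.e. Lüscher's zero-mode asymptotics for the whole low-lying zero-flux
spectrum, uniformly on the approach to the small-volume continuum limit: the RG content of the crux, in level currency.

HONEST FRAMING: a reduction; the three hypotheses are OPEN (XL: constructive control of the femto-universe continuum limit of the lattice
transfer spectrum is not in print); femto rung R2b1 only; not infinite volume, not a gap, not Clay.
-/

set_option autoImplicit false

noncomputable section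

open MeasureTheory Filter Topology Real
open Literature.MathematicalPhysics.QuantumFieldTheory hiding SU2
open Literature.MathematicalPhysics.QuantumLattice
open Literature.Analysis.OperatorTheory.YMMatrixModel
open scoped BigOperators

namespace Summit.QuantumFields.YangMills.Theorems.FemtoTransferGap.TwoLattice

open Summit.QuantumFields.YangMills.Theorems.FemtoTransferGap
open Summit.QuantumFields.YangMills.Theorems.FemtoTransferGap.TraceDoor
open Summit.QuantumFields.YangMills.Theorems.FemtoTransferGap.TT (physTrace)

namespace Tower

/-! ## §1 Uniform threshold bookkeeping -/

/-- In a window of depth `lam ≤ τ/2` the femto unit `u = Λ/L` is at most `τ`, positive, and `β ≥ 1` — uniformly in `L`. [folklore] -/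
theorem unit_small_of_window {lam β τ : ℝ} {L : ℕ} [NeZero L] (hlam : 0 < lam) (hle : lam ≤ τ / 2) (hW : InFemtoWindow lam β L) :
    1 ≤ β ∧ 0 < luscherLambda β L / L ∧ luscherLambda β L / L ≤ τ :=
  ⟨hW.1, Base.unit_pos_of_window hlam hW, (Base.unit_le_of_window hlam hW).trans (by linarith)⟩

/-- Finite minimum of positive depths without `Finset.inf'`: `1/(Σ_{k<K} lam_k⁻¹ + 1)` is positive and below every `lam_k`, `k < K`.
[folklore] -/
theorem recipSum_le {K : ℕ} {lamk : ℕ → ℝ} (hpos : ∀ k, 0 < lamk k) {k : ℕ} (hk : k ∈ Finset.range K) :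
    1 / (∑ j ∈ Finset.range K, (lamk j)⁻¹ + 1) ≤ lamk k := by
  have hS : (lamk k)⁻¹ ≤ ∑ j ∈ Finset.range K, (lamk j)⁻¹ :=
    Finset.single_le_sum (f := fun j => (lamk j)⁻¹) (fun j _ => (inv_pos.2 (hpos j)).le) hk
  have hik : 0 < (lamk k)⁻¹ := inv_pos.2 (hpos k)
  calc 1 / (∑ j ∈ Finset.range K, (lamk j)⁻¹ + 1) ≤ 1 / (lamk k)⁻¹ :=
        one_div_le_one_div_of_le hik (by linarith)
    _ = lamk k := by rw [one_div, inv_inv]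

/-- The reciprocal-sum depth is positive. [folklore] -/
theorem recipSum_pos {K : ℕ} {lamk : ℕ → ℝ} (hpos : ∀ k, 0 < lamk k) :
    0 < 1 / (∑ j ∈ Finset.range K, (lamk j)⁻¹ + 1) := by
  have : 0 ≤ ∑ j ∈ Finset.range K, (lamk j)⁻¹ := Finset.sum_nonneg fun j _ => (inv_pos.2 (hpos j)).le
  positivity

/-! ## §2 Uniform termwise, moment and ratio limits (the `L`-uniform twins of `Base.term_close` / `moment_close` / `levelRatio_close`) -/

set_option maxHeartbeats 400000 in
/-- **Uniform termwise limit from U-UPPER ∧ U-LOWER.**  For each level `k`: deep in the window (threshold `L0` uniform in `lam`),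
`|x_k^T − e^{−sΔ_k}| ≤ ε` for every `T` with `s ≤ T·u ≤ s + 2u` (`u = Λ(β,L)/L`). [cite: Luscher1983, §3] -/
theorem uterm_close
    (hUp : ∀ k : ℕ, ∀ d : ℝ, d < levelGap k → ∃ L0 : ℕ, ∃ lam0 : ℝ, 0 < lam0 ∧ ∀ lam : ℝ, 0 < lam → lam ≤ lam0 →
      ∀ (L : ℕ) [NeZero L], L0 ≤ L → ∀ β : ℝ, InFemtoWindow lam β L →
        levelValue su2Rep L β k ≤ Real.exp (-(d * luscherLambda β L) / L) * levelValue su2Rep L β 0)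
    (hLow : ∀ k : ℕ, ∀ ε : ℝ, 0 < ε → ∃ L0 : ℕ, ∃ lam0 : ℝ, 0 < lam0 ∧ ∀ lam : ℝ, 0 < lam → lam ≤ lam0 →
      ∀ (L : ℕ) [NeZero L], L0 ≤ L → ∀ β : ℝ, InFemtoWindow lam β L →
        Real.exp (-((levelGap k + ε) * luscherLambda β L) / L) * levelValue su2Rep L β 0 ≤ levelValue su2Rep L β k)
    (k : ℕ) {s : ℝ} (hs : 0 < s) {ε : ℝ} (hε : 0 < ε) :
    ∃ L0 : ℕ, ∃ lam0 : ℝ, 0 < lam0 ∧ ∀ lam : ℝ, 0 < lam → lam ≤ lam0 → ∀ (L : ℕ) [NeZero L], L0 ≤ L →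
      ∀ β : ℝ, InFemtoWindow lam β L → ∀ T : ℕ, s ≤ (T : ℝ) * (luscherLambda β L / L) →
        (T : ℝ) * (luscherLambda β L / L) ≤ s + 2 * (luscherLambda β L / L) →
          |(levelValue su2Rep L β k / levelValue su2Rep L β 0) ^ T - Real.exp (-s * levelGap k)| ≤ ε := by
  -- adapted from `Base.term_close` (ym-luscher-20007-p1 g5), thresholds `(L0, lam0)` instead of `β1`
  have hΔ : 0 ≤ levelGap k := levelGap_nonneg k
  set m : ℝ := min 1 (ε / 2) with hm
  have hmpos : 0 < m := lt_min one_pos (by positivity)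
  have hm1 : m ≤ 1 := min_le_left _ _
  have hmε : m ≤ ε / 2 := min_le_right _ _
  set η : ℝ := m / (2 * (s + 1)) with hη
  have hηpos : 0 < η := by rw [hη]; positivity
  have hηs : η * s ≤ m / 2 := by
    rw [hη, div_mul_eq_mul_div, div_le_iff₀ (by positivity)]
    nlinarith [hmpos.le, hs.le]
  set τ : ℝ := m / (4 * (levelGap k + η + 1)) with hτ
  have hτpos : 0 < τ := by rw [hτ]; positivity
  have hτb : 2 * (levelGap k + η) * τ ≤ m / 2 := by
    rw [hτ]
    have hD : 0 < levelGap k + η + 1 := by positivity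
    rw [show 2 * (levelGap k + η) * (m / (4 * (levelGap k + η + 1))) =
        m / 2 * ((levelGap k + η) / (levelGap k + η + 1)) by field_simp; ring]
    have : (levelGap k + η) / (levelGap k + η + 1) ≤ 1 := by rw [div_le_one hD]; linarith
    calc m / 2 * ((levelGap k + η) / (levelGap k + η + 1)) ≤ m / 2 * 1 :=
          mul_le_mul_of_nonneg_left this (by positivity)
      _ = m / 2 := mul_one _
  -- U-UPPER at `d = Δ_k − η`, U-LOWER at `η`; the unit is small once `lam ≤ τ/2`
  obtain ⟨L0U, lamU, hlamU, hU⟩ := hUp k (levelGap k - η) (by linarith)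
  obtain ⟨L0L, lamL, hlamL, hL⟩ := hLow k η hηpos
  refine ⟨max L0U L0L, min (min lamU lamL) (τ / 2), lt_min (lt_min hlamU hlamL) (by positivity), ?_⟩
  intro lam hlam hle L _ hL0 β hW T hT1 hT2
  have hleU : lam ≤ lamU := hle.trans ((min_le_left _ _).trans (min_le_left _ _))
  have hleL : lam ≤ lamL := hle.trans ((min_le_left _ _).trans (min_le_right _ _))
  have hleτ : lam ≤ τ / 2 := hle.trans (min_le_right _ _)
  obtain ⟨_, hupos, huτ⟩ := unit_small_of_window hlam hleτ hW
  have hup := hU lam hlam hleU L ((le_max_left _ _).trans hL0) β hW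
  have hlow := hL lam hlam hleL L ((le_max_right _ _).trans hL0) β hW
  set u : ℝ := luscherLambda β L / L with hu
  set Δ := levelGap k with hΔdef
  have hpos0 : 0 < levelValue su2Rep L β 0 := levelValue_zero_su2Rep_pos L β
  set x := levelValue su2Rep L β k / levelValue su2Rep L β 0 with hx
  have e1 : -((Δ - η) * luscherLambda β L) / L = -((Δ - η) * u) := by rw [hu]; ring
  have e2 : -((Δ + η) * luscherLambda β L) / L = -((Δ + η) * u) := by rw [hu]; ring
  rw [e1] at hup
  rw [e2] at hlow
  have hxup : x ≤ Real.exp (-((Δ - η) * u)) := by rw [hx, div_le_iff₀ hpos0]; exact hup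
  have hxlow : Real.exp (-((Δ + η) * u)) ≤ x := by rw [hx, le_div_iff₀ hpos0]; exact hlow
  have hxpos : 0 < x := lt_of_lt_of_le (Real.exp_pos _) hxlow
  have hTup : x ^ T ≤ Real.exp (-((Δ - η) * u)) ^ T := pow_le_pow_left₀ hxpos.le hxup T
  have hTlow : Real.exp (-((Δ + η) * u)) ^ T ≤ x ^ T := pow_le_pow_left₀ (Real.exp_pos _).le hxlow T
  rw [← Real.exp_nat_mul] at hTup hTlow
  -- ρ := η s + 2 (Δ + η) u ≤ m ≤ min 1 (ε/2)
  set ρ : ℝ := η * s + 2 * (Δ + η) * u with hρ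
  have hρ0 : 0 ≤ ρ := by rw [hρ]; positivity
  have hρm : ρ ≤ m := by
    have : 2 * (Δ + η) * u ≤ 2 * (Δ + η) * τ := mul_le_mul_of_nonneg_left huτ (by positivity)
    linarith
  have hρ1 : ρ ≤ 1 := hρm.trans hm1
  have hρε : ρ ≤ ε / 2 := hρm.trans hmε
  have hTu0 : 0 ≤ (T : ℝ) * u := by positivity
  have key1 : (T : ℝ) * -((Δ - η) * u) ≤ -(s * Δ) + ρ := by
    have h1 : (T : ℝ) * -((Δ - η) * u) = -(Δ * ((T : ℝ) * u)) + η * ((T : ℝ) * u) := by ring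
    rw [h1, hρ]
    have h2 : Δ * s ≤ Δ * ((T : ℝ) * u) := mul_le_mul_of_nonneg_left hT1 hΔ
    have h3 : η * ((T : ℝ) * u) ≤ η * (s + 2 * u) := mul_le_mul_of_nonneg_left hT2 hηpos.le
    have h4 : 0 ≤ 2 * Δ * u := by positivity
    nlinarith
  have key2 : -(s * Δ) - ρ ≤ (T : ℝ) * -((Δ + η) * u) := by
    have h1 : (T : ℝ) * -((Δ + η) * u) = -((Δ + η) * ((T : ℝ) * u)) := by ring
    rw [h1, hρ]
    have h2 : (Δ + η) * ((T : ℝ) * u) ≤ (Δ + η) * (s + 2 * u) := mul_le_mul_of_nonneg_left hT2 (by positivity)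
    nlinarith
  have hxT_up : x ^ T ≤ Real.exp (-(s * Δ) + ρ) := hTup.trans (Real.exp_le_exp.2 key1)
  have hxT_low : Real.exp (-(s * Δ) - ρ) ≤ x ^ T := (Real.exp_le_exp.2 key2).trans hTlow
  have hfin := Base.abs_sub_exp_le_of_sandwich (mul_nonneg hs.le hΔ) hρ0 hρ1 hxT_low hxT_up
  rw [show -s * Δ = -(s * Δ) by ring]
  linarith

set_option maxHeartbeats 400000 in
/-- **Uniform moment limit from U-UPPER ∧ U-LOWER ∧ U-TAIL + `LevelGapSummable`.**  Deep in the window (threshold `L0` uniform in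
`lam`): `Σ_k x_k^T` converges and `|Σ_k x_k^T − Σ_k e^{−sΔ_k}| ≤ ε` for every `T` with `s ≤ T·u ≤ s + 2u`. [cite: Luscher1983, §3] -/
theorem umoment_close
    (hUp : ∀ k : ℕ, ∀ d : ℝ, d < levelGap k → ∃ L0 : ℕ, ∃ lam0 : ℝ, 0 < lam0 ∧ ∀ lam : ℝ, 0 < lam → lam ≤ lam0 →
      ∀ (L : ℕ) [NeZero L], L0 ≤ L → ∀ β : ℝ, InFemtoWindow lam β L →
        levelValue su2Rep L β k ≤ Real.exp (-(d * luscherLambda β L) / L) * levelValue su2Rep L β 0)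
    (hLow : ∀ k : ℕ, ∀ ε : ℝ, 0 < ε → ∃ L0 : ℕ, ∃ lam0 : ℝ, 0 < lam0 ∧ ∀ lam : ℝ, 0 < lam → lam ≤ lam0 →
      ∀ (L : ℕ) [NeZero L], L0 ≤ L → ∀ β : ℝ, InFemtoWindow lam β L →
        Real.exp (-((levelGap k + ε) * luscherLambda β L) / L) * levelValue su2Rep L β 0 ≤ levelValue su2Rep L β k)
    (hTail : ∀ s : ℝ, 0 < s → ∀ ε : ℝ, 0 < ε → ∃ K : ℕ, ∃ L0 : ℕ, ∃ lam0 : ℝ, 0 < lam0 ∧ ∀ lam : ℝ, 0 < lam → lam ≤ lam0 →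
      ∀ (L : ℕ) [NeZero L], L0 ≤ L → ∀ β : ℝ, InFemtoWindow lam β L →
        ∀ T : ℕ, s ≤ 2 * ((T : ℝ) * (luscherLambda β L / L)) →
          ∑' k : ℕ, (levelValue su2Rep L β (k + K) / levelValue su2Rep L β 0) ^ T ≤ ε)
    {s : ℝ} (hs : 0 < s) {ε : ℝ} (hε : 0 < ε) :
    ∃ L0 : ℕ, ∃ lam0 : ℝ, 0 < lam0 ∧ ∀ lam : ℝ, 0 < lam → lam ≤ lam0 → ∀ (L : ℕ) [NeZero L], L0 ≤ L →
      ∀ β : ℝ, InFemtoWindow lam β L → ∀ T : ℕ, s ≤ (T : ℝ) * (luscherLambda β L / L) →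
        (T : ℝ) * (luscherLambda β L / L) ≤ s + 2 * (luscherLambda β L / L) →
          Summable (fun k : ℕ => (levelValue su2Rep L β k / levelValue su2Rep L β 0) ^ T) ∧
          |(∑' k : ℕ, (levelValue su2Rep L β k / levelValue su2Rep L β 0) ^ T) - ∑' k : ℕ, Real.exp (-s * levelGap k)| ≤ ε := by
  -- adapted from `Base.moment_close` (ym-luscher-20007-p1 g5), thresholds `(L0, lam0)` instead of `β2`
  have hε4 : 0 < ε / 4 := by positivity
  have hM : Summable (fun k => Real.exp (-s * levelGap k)) := LGS.levelGapSummable_all s hs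
  have hMtail : ∀ᶠ i : ℕ in atTop, ∑' k, Real.exp (-s * levelGap (k + i)) < ε / 4 :=
    (tendsto_sum_nat_add (fun k => Real.exp (-s * levelGap k))).eventually (eventually_lt_nhds hε4)
  obtain ⟨N, hN⟩ := Filter.eventually_atTop.1 hMtail
  obtain ⟨K1, L0T, lamT, hlamT, hT1⟩ := hTail s hs (ε / 4) hε4
  set K : ℕ := K1 + N with hK
  have hε' : 0 < ε / (4 * ((K : ℝ) + 1)) := by positivity
  choose L0k lamk hlamk hk using fun k => uterm_close hUp hLow k hs hε'
  set L0fin : ℕ := ∑ k ∈ Finset.range K, L0k k with hL0fin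
  set lamfin : ℝ := 1 / (∑ j ∈ Finset.range K, (lamk j)⁻¹ + 1) with hlamfin
  have hlamfin_pos : 0 < lamfin := recipSum_pos hlamk
  have hs4 : 0 < s / 4 := by positivity
  refine ⟨max L0T L0fin, min (min lamT lamfin) (s / 4), lt_min (lt_min hlamT hlamfin_pos) hs4, ?_⟩
  intro lam hlam hle L _ hL0 β hW T hTs hTs2
  have hleT : lam ≤ lamT := hle.trans ((min_le_left _ _).trans (min_le_left _ _))
  have hlefin : lam ≤ lamfin := hle.trans ((min_le_left _ _).trans (min_le_right _ _))
  have hles : lam ≤ s / 2 / 2 := hle.trans ((min_le_right _ _).trans (by linarith))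
  have hL0T' : L0T ≤ L := (le_max_left _ _).trans hL0
  have hL0fin' : L0fin ≤ L := (le_max_right _ _).trans hL0
  obtain ⟨hβ1, hupos, hule⟩ := unit_small_of_window hlam hles hW
  set u : ℝ := luscherLambda β L / L with hu
  -- `T ≥ 2`: `2u ≤ s ≤ T u`
  have hT2 : 2 ≤ T := by
    have h1 : (2 : ℝ) * u ≤ (T : ℝ) * u := by linarith
    have h2 : (2 : ℝ) ≤ (T : ℝ) := le_of_mul_le_mul_right h1 hupos
    exact_mod_cast h2
  have hsum : Summable (fun k : ℕ => (levelValue su2Rep L β k / levelValue su2Rep L β 0) ^ T) :=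
    Base.summable_xpow L hβ1 hT2
  refine ⟨hsum, ?_⟩
  have hwin : s ≤ 2 * ((T : ℝ) * u) := by nlinarith [hupos.le]
  have htail : ∑' k : ℕ, (levelValue su2Rep L β (k + K1) / levelValue su2Rep L β 0) ^ T ≤ ε / 4 :=
    hT1 lam hlam hleT L hL0T' β hW T hwin
  set f : ℕ → ℝ := fun k => (levelValue su2Rep L β k / levelValue su2Rep L β 0) ^ T with hf
  set g : ℕ → ℝ := fun k => Real.exp (-s * levelGap k) with hg
  have hβ0' : (0 : ℝ) ≤ β := by linarith
  have hf0 : ∀ k, 0 ≤ f k := fun k =>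
    pow_nonneg (div_nonneg (levelValue_su2Rep_nonneg L hβ0' k) (levelValue_su2Rep_nonneg L hβ0' 0)) T
  have hg0 : ∀ k, 0 ≤ g k := fun k => (Real.exp_pos _).le
  have hfdec := hsum.sum_add_tsum_nat_add K
  have hgdec := hM.sum_add_tsum_nat_add K
  have hftail : ∑' i, f (i + K) ≤ ε / 4 := (OST.tsum_shift_le hsum hf0 K1 N).trans htail
  have hgtail : ∑' i, g (i + K) < ε / 4 := hN K (by omega)
  have hftail0 : 0 ≤ ∑' i, f (i + K) := tsum_nonneg fun i => hf0 _
  have hgtail0 : 0 ≤ ∑' i, g (i + K) := tsum_nonneg fun i => hg0 _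
  have hfin : ∑ k ∈ Finset.range K, |f k - g k| ≤ ∑ k ∈ Finset.range K, ε / (4 * ((K : ℝ) + 1)) := by
    refine Finset.sum_le_sum fun k hk' => ?_
    have hLk : L0k k ≤ L :=
      (Finset.single_le_sum (f := fun k => L0k k) (fun i _ => Nat.zero_le _) hk').trans hL0fin'
    have hlk : lam ≤ lamk k := hlefin.trans (recipSum_le hlamk hk')
    exact hk k lam hlam hlk L hLk β hW T hTs hTs2
  have hfin' : ∑ k ∈ Finset.range K, |f k - g k| ≤ ε / 4 := by
    refine hfin.trans ?_
    rw [Finset.sum_const, Finset.card_range, nsmul_eq_mul]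
    have hK1 : (0 : ℝ) < (K : ℝ) + 1 := by positivity
    rw [show (K : ℝ) * (ε / (4 * ((K : ℝ) + 1))) = ε / 4 * ((K : ℝ) / ((K : ℝ) + 1)) by field_simp]
    have : (K : ℝ) / ((K : ℝ) + 1) ≤ 1 := by rw [div_le_one hK1]; linarith
    calc ε / 4 * ((K : ℝ) / ((K : ℝ) + 1)) ≤ ε / 4 * 1 := mul_le_mul_of_nonneg_left this hε4.le
      _ = ε / 4 := mul_one _
  have hfinabs : |∑ k ∈ Finset.range K, f k - ∑ k ∈ Finset.range K, g k| ≤ ε / 4 := by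
    rw [← Finset.sum_sub_distrib]; exact (Finset.abs_sum_le_sum_abs _ _).trans hfin'
  rw [← hfdec, ← hgdec]
  have hsplit : (∑ k ∈ Finset.range K, f k + ∑' i, f (i + K)) - (∑ k ∈ Finset.range K, g k + ∑' i, g (i + K)) =
      (∑ k ∈ Finset.range K, f k - ∑ k ∈ Finset.range K, g k) + (∑' i, f (i + K) - ∑' i, g (i + K)) := by ring
  rw [hsplit]
  calc |(∑ k ∈ Finset.range K, f k - ∑ k ∈ Finset.range K, g k) + (∑' i, f (i + K) - ∑' i, g (i + K))|
      ≤ |∑ k ∈ Finset.range K, f k - ∑ k ∈ Finset.range K, g k| + |∑' i, f (i + K) - ∑' i, g (i + K)| := abs_add_le _ _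
    _ ≤ ε / 4 + (ε / 4 + ε / 4) := add_le_add hfinabs (by rw [abs_le]; constructor <;> linarith)
    _ ≤ ε := by linarith

/-- **The level ratio tends to `r_𝔥(s)` at `T = femtoSteps`, uniformly in `L`** (from U-UPPER ∧ U-LOWER ∧ U-TAIL): deep in the window
(threshold `L0` uniform in `lam`), `|levelRatio L β ⌈sL/Λ⌉ − hTraceRatio s| ≤ ε`, together with `β ≥ 1` and `T ≥ 2`. [cite: Luscher1983, §3] -/
theorem ulevelRatio_close
    (hUp : ∀ k : ℕ, ∀ d : ℝ, d < levelGap k → ∃ L0 : ℕ, ∃ lam0 : ℝ, 0 < lam0 ∧ ∀ lam : ℝ, 0 < lam → lam ≤ lam0 →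
      ∀ (L : ℕ) [NeZero L], L0 ≤ L → ∀ β : ℝ, InFemtoWindow lam β L →
        levelValue su2Rep L β k ≤ Real.exp (-(d * luscherLambda β L) / L) * levelValue su2Rep L β 0)
    (hLow : ∀ k : ℕ, ∀ ε : ℝ, 0 < ε → ∃ L0 : ℕ, ∃ lam0 : ℝ, 0 < lam0 ∧ ∀ lam : ℝ, 0 < lam → lam ≤ lam0 →
      ∀ (L : ℕ) [NeZero L], L0 ≤ L → ∀ β : ℝ, InFemtoWindow lam β L →
        Real.exp (-((levelGap k + ε) * luscherLambda β L) / L) * levelValue su2Rep L β 0 ≤ levelValue su2Rep L β k)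
    (hTail : ∀ s : ℝ, 0 < s → ∀ ε : ℝ, 0 < ε → ∃ K : ℕ, ∃ L0 : ℕ, ∃ lam0 : ℝ, 0 < lam0 ∧ ∀ lam : ℝ, 0 < lam → lam ≤ lam0 →
      ∀ (L : ℕ) [NeZero L], L0 ≤ L → ∀ β : ℝ, InFemtoWindow lam β L →
        ∀ T : ℕ, s ≤ 2 * ((T : ℝ) * (luscherLambda β L / L)) →
          ∑' k : ℕ, (levelValue su2Rep L β (k + K) / levelValue su2Rep L β 0) ^ T ≤ ε)
    {s : ℝ} (hs : 0 < s) {ε : ℝ} (hε : 0 < ε) :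
    ∃ L0 : ℕ, ∃ lam0 : ℝ, 0 < lam0 ∧ ∀ lam : ℝ, 0 < lam → lam ≤ lam0 → ∀ (L : ℕ) [NeZero L], L0 ≤ L →
      ∀ β : ℝ, InFemtoWindow lam β L →
        1 ≤ β ∧ 2 ≤ femtoSteps s β L ∧ |levelRatio L β (femtoSteps s β L) - hTraceRatio s| ≤ ε := by
  -- adapted from `Base.levelRatio_close` (ym-luscher-20007-p1 g5), thresholds `(L0, lam0)` instead of `β1`
  have hε3 : 0 < ε / 3 := by positivity
  have h2s : 0 < 2 * s := by positivity
  obtain ⟨L02, lam2, hlam2, h2⟩ := umoment_close hUp hLow hTail hs hε3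
  obtain ⟨L02', lam2', hlam2', h2'⟩ := umoment_close hUp hLow hTail h2s hε3
  have hs4 : 0 < s / 4 := by positivity
  refine ⟨max L02 L02', min (min lam2 lam2') (s / 4), lt_min (lt_min hlam2 hlam2') hs4, ?_⟩
  intro lam hlam hle L _ hL0 β hW
  have hle2 : lam ≤ lam2 := hle.trans ((min_le_left _ _).trans (min_le_left _ _))
  have hle2' : lam ≤ lam2' := hle.trans ((min_le_left _ _).trans (min_le_right _ _))
  have hles : lam ≤ s / 2 / 2 := hle.trans ((min_le_right _ _).trans (by linarith))
  obtain ⟨hβ1, hupos, hule⟩ := unit_small_of_window hlam hles hW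
  set u : ℝ := luscherLambda β L / L with hu
  set T := femtoSteps s β L with hTdef
  obtain ⟨hT1, hT2⟩ := Base.femtoSteps_mul_unit (L1 := L) hs.le hlam hW
  have hT2' : (T : ℝ) * u ≤ s + 2 * u := by rw [hu]; linarith [hupos]
  have hTT1 : 2 * s ≤ ((2 * T : ℕ) : ℝ) * u := by push_cast; linarith
  have hTT2 : ((2 * T : ℕ) : ℝ) * u ≤ 2 * s + 2 * u := by push_cast; linarith
  have hTge2 : 2 ≤ T := by
    have h1 : (2 : ℝ) * u ≤ (T : ℝ) * u := by linarith
    have h2 : (2 : ℝ) ≤ (T : ℝ) := le_of_mul_le_mul_right h1 hupos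
    exact_mod_cast h2
  obtain ⟨hsum1, hm1⟩ := h2 lam hlam hle2 L ((le_max_left _ _).trans hL0) β hW T hT1 hT2'
  obtain ⟨hsum2, hm2⟩ := h2' lam hlam hle2' L ((le_max_right _ _).trans hL0) β hW (2 * T) hTT1 hTT2
  refine ⟨hβ1, hTge2, ?_⟩
  have hB0' : (0 : ℝ) ≤ β := by linarith
  have hone : 1 ≤ ∑' k : ℕ, (levelValue su2Rep L β k / levelValue su2Rep L β 0) ^ T := by
    have h := hsum1.le_tsum 0 (fun j _ =>
      pow_nonneg (div_nonneg (levelValue_su2Rep_nonneg L hB0' j) (levelValue_su2Rep_nonneg L hB0' 0)) T)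
    have h0 : (levelValue su2Rep L β 0 / levelValue su2Rep L β 0) ^ T = 1 := by
      rw [div_self (levelValue_zero_su2Rep_pos L β).ne', one_pow]
    rw [h0] at h; exact h
  have hone' : 1 ≤ ∑' k : ℕ, Real.exp (-s * levelGap k) := by
    have h := (LGS.levelGapSummable_all s hs).le_tsum 0 (fun j _ => (Real.exp_pos _).le)
    rw [levelGap_zero, mul_zero, Real.exp_zero] at h; exact h
  have hA' : 0 ≤ ∑' k : ℕ, Real.exp (-(2 * s) * levelGap k) := tsum_nonneg fun k => (Real.exp_pos _).le
  have hA'B' : ∑' k : ℕ, Real.exp (-(2 * s) * levelGap k) ≤ ∑' k : ℕ, Real.exp (-s * levelGap k) := by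
    refine Summable.tsum_le_tsum (fun k => ?_) (LGS.levelGapSummable_all (2 * s) h2s) (LGS.levelGapSummable_all s hs)
    refine Real.exp_le_exp.2 ?_
    have : 0 ≤ s * levelGap k := mul_nonneg hs.le (levelGap_nonneg k)
    linarith
  show |(∑' k : ℕ, (levelValue su2Rep L β k / levelValue su2Rep L β 0) ^ (2 * T)) /
      (∑' k : ℕ, (levelValue su2Rep L β k / levelValue su2Rep L β 0) ^ T) ^ 2 -
      (∑' k : ℕ, Real.exp (-(2 * s) * levelGap k)) / (∑' k : ℕ, Real.exp (-s * levelGap k)) ^ 2| ≤ ε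
  refine (ratio_sub_ratio_le hone hone' hA' hA'B').trans ?_
  linarith [hm1, hm2]

/-! ## §3 ★ The uniform femto trace law from the three `L`-uniform level statements -/

/-- ★ **`UTL` from U-UPPER ∧ U-LOWER ∧ U-TAIL** (conclusion = the uniform femto trace law, the hypothesis of
`Tower.twoLatticeUniversality_of_uniform`, which turns it into S-TOWER by name): deep in the window, with an `L0` that does not depend on
the depth `lam`, `|traceRatio L β (femtoSteps s β L) − hTraceRatio s| ≤ ε`.  LEVEL = TRACE currency by the closed child `TraceFormula`.
[cite: Luscher1983, §3] [cite: MontvayMunster1994, (3.145)] -/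
theorem uniformTraceLaw_of_ucoarse
    (hUp : ∀ k : ℕ, ∀ d : ℝ, d < levelGap k → ∃ L0 : ℕ, ∃ lam0 : ℝ, 0 < lam0 ∧ ∀ lam : ℝ, 0 < lam → lam ≤ lam0 →
      ∀ (L : ℕ) [NeZero L], L0 ≤ L → ∀ β : ℝ, InFemtoWindow lam β L →
        levelValue su2Rep L β k ≤ Real.exp (-(d * luscherLambda β L) / L) * levelValue su2Rep L β 0)
    (hLow : ∀ k : ℕ, ∀ ε : ℝ, 0 < ε → ∃ L0 : ℕ, ∃ lam0 : ℝ, 0 < lam0 ∧ ∀ lam : ℝ, 0 < lam → lam ≤ lam0 →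
      ∀ (L : ℕ) [NeZero L], L0 ≤ L → ∀ β : ℝ, InFemtoWindow lam β L →
        Real.exp (-((levelGap k + ε) * luscherLambda β L) / L) * levelValue su2Rep L β 0 ≤ levelValue su2Rep L β k)
    (hTail : ∀ s : ℝ, 0 < s → ∀ ε : ℝ, 0 < ε → ∃ K : ℕ, ∃ L0 : ℕ, ∃ lam0 : ℝ, 0 < lam0 ∧ ∀ lam : ℝ, 0 < lam → lam ≤ lam0 →
      ∀ (L : ℕ) [NeZero L], L0 ≤ L → ∀ β : ℝ, InFemtoWindow lam β L →
        ∀ T : ℕ, s ≤ 2 * ((T : ℝ) * (luscherLambda β L / L)) →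
          ∑' k : ℕ, (levelValue su2Rep L β (k + K) / levelValue su2Rep L β 0) ^ T ≤ ε) :
    ∀ s : ℝ, 0 < s → ∀ ε : ℝ, 0 < ε → ∃ L0 : ℕ, ∃ lam0 : ℝ, 0 < lam0 ∧ ∀ lam : ℝ, 0 < lam → lam ≤ lam0 →
      ∀ (L : ℕ) [NeZero L], L0 ≤ L → ∀ β : ℝ, InFemtoWindow lam β L →
        |traceRatio L β (femtoSteps s β L) - hTraceRatio s| ≤ ε := by
  intro s hs ε hε
  obtain ⟨L0, lam0, hlam0, h⟩ := ulevelRatio_close hUp hLow hTail hs hε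
  refine ⟨L0, lam0, hlam0, ?_⟩
  intro lam hlam hle L _ hL0 β hW
  obtain ⟨hβ1, hT2, hclose⟩ := h lam hlam hle L hL0 β hW
  rw [Base.traceRatio_eq_levelRatio L hβ1 hT2]
  exact hclose

end Tower

end Summit.QuantumFields.YangMills.Theorems.FemtoTransferGap.TwoLattice

end
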